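import Literature.Analysis.FluidPDE.TorusNS2DLadderNonlinear
import Literature.Analysis.FluidPDE.TorusClassicalH1Balance
import Literature.Analysis.FunctionSpaces.TorusEnstrophyOrthogonality
import Mathlib.Analysis.ODE.Gronwall
import HarnessLib

/-!
# A priori bounds for every `H^N` energy of classical forced Navier–Stokes solutions on the two-torus
# (Ladyzhenskaya 1959: two-dimensional flows do not lose regularity)

Analysis/FluidPDE proof file (theorems only; no definitions, no named facts).  For a classical solution
`(u, p)` of `∂ₜu + (u·∇)u = νΔu − ∇p + f`, `div u = 0` on `[a, b] × 𝕋²`, `ν > 0`, every word energy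
`E_N(u(t)) = ∑_{|w|=N} ∫ ‖∂^w u(t)‖²` (`Torus.wordEnergy`, `= ‖∇ᴺu‖²₂` over all ordered words) stays bounded
on `[a, b]` by a constant that depends ONLY on `N`, `ν`, a bound `τ ≥ b − a` for the length of the window,
a bound `D` for `E_0(u(a)), …, E_N(u(a))` and a bound `Φ` for `E_0(f(t)), …, E_N(f(t))` on the window — and
NOT on the solution or on the window otherwise (`Torus.exists_wordEnergy_le_fin_two`).  This is the
a priori half of the global regularity of two-dimensional Navier–Stokes flows (Ladyzhenskaya 1959, Thm. 1;
Foias–Manley–Rosa–Temam 2001, Ch. II Thm. 7.4 & App. II.A (A.62)–(A.67): the enstrophy equation has no cubic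
term in 2D; Temam 1995, Part I, Thm. 3.2; Kuksin–Shirikyan 2012, Thm. 2.1.18–19 and Cor. 2.1.20; in the
`H^m` form: Majda–Bertozzi 2002, §3.3 with Cor. 3.3), organised rung by rung:

* `E_0`: the energy balance, `d/dt ½E_0 = −νE_1 + ∫⟪f, u⟫` (the transport term `∫⟪(u·∇)u, u⟫` vanishes,
  tree `integral_inner_convect_self_right_eq_zero`) ⇒ `Ė_0 ≤ E_0 + E_0(f)`;
* `E_1` (TWO-DIMENSIONAL): `d/dt ½E_1 = −νE_2 + ∫⟪(u·∇)u, Δu⟫ − ∫⟪f, Δu⟫`-type balance with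
  `∫⟪Δu, (u·∇)u⟫ = 0` on `𝕋²` (FMRT (A.62), tree `integral_inner_laplacian_convect_self_eq_zero`) ⇒
  `Ė_1 ≤ E_1 + E_1(f)` (`Torus.ladderNonlinear_one_eq_zero_fin_two`);
* `E_N`, `N ≥ 2` (TWO-DIMENSIONAL): the balance `d/dt ½E_N = −νE_{N+1} − NL_N + W_N` (tree
  `IsClassicalNSSolutionOn.hasDerivWithinAt_half_wordEnergy`) with Ladyzhenskaya's bound
  `|NL_N| ≤ c_N K (E_N + K + (E_N E_{N+1})^{1/2})` (`TorusNS2DLadderNonlinear`) once `E_1, …, E_{N−1} ≤ K`;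
  the dissipation absorbs `(E_N E_{N+1})^{1/2}` and a LINEAR differential inequality
  `Ė_N ≤ A E_N + B`, `A = c²K²/ν + 2cK + 1`, `B = 2cK² + Φ`, remains;
* Grönwall on `[a, b]` (Mathlib `le_gronwallBound_of_liminf_deriv_right_le`) and induction on `N`.

Consumed by `TorusNS2DGlobalExistence` (continuation of classical solutions with the restart theorem of
`TorusClassicalNSForcedRestart`).  WHAT THIS IS NOT: nothing in dimension three.

## Tree / Mathlib search

Reused: `IsClassicalNSSolutionOn.hasDerivWithinAt_half_wordEnergy`, `Torus.abs_wordForcing_le`,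
`Torus.ladderNonlinear`, `Torus.wordForcing` (`TorusNSLadderInequality`), `Torus.exists_abs_ladderNonlinear_le_fin_two`
(`TorusNS2DLadderNonlinear`), `integral_inner_convect_self_right_eq_zero` (`TorusClassicalNSUniqueness`),
`integral_inner_laplacian_convect_self_eq_zero` (`TorusEnstrophyOrthogonality`),
`Torus.sum_integral_inner_partialDeriv_eq_neg_integral_inner_laplacian` (`TorusClassicalH1Balance`);
Mathlib `le_gronwallBound_of_liminf_deriv_right_le`, `gronwallBound_of_K_ne_0`.
`lean search 'wordEnergy_le_fin_two|apriori.*fin_two|ladderNonlinear_one'`: no hits.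

## References

* O. A. Ladyzhenskaya, CPAM 12 (1959) 427–433, Thm. 1 (global unique solvability in two dimensions). [Ladyzhenskaya1959]
* C. Foias, O. Manley, R. Rosa, R. Temam, *Navier–Stokes Equations and Turbulence*, CUP 2001, Ch. II Thm. 7.4,
  App. II.A (A.62)–(A.67). [FoiasManleyRosaTemam2001]
* S. Kuksin, A. Shirikyan, *Mathematics of Two-Dimensional Turbulence*, CUP 2012, Thm. 2.1.18–2.1.19,
  Cor. 2.1.20. [KuksinShirikyan2012]
* A. J. Majda, A. L. Bertozzi, *Vorticity and Incompressible Flow*, CUP 2002, §3.3, Cor. 3.3. [MajdaBertozziCUP2002]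
-/

noncomputable section

open MeasureTheory Set Function Filter
open scoped ContDiff InnerProductSpace RealInnerProductSpace Topology

namespace Literature.Analysis.FluidPDE

namespace Torus

open FunctionSpaces FunctionSpaces.Torus

/-! ## §1 A Grönwall lemma on a closed window in explicit form -/

section Gronwall

/-- **Linear Grönwall inequality on a closed window, explicit form.**  If `E` has one-sided derivatives
`E'(t)` within `[a, b]`, `E'(t) ≤ A E(t) + B` with `A ≥ 1`, `B ≥ 0`, `E(a) ≥ 0` and `b − a ≤ τ`, then
`E(t) ≤ (E(a) + B) e^{Aτ}` on `[a, b]` (Mathlib's `le_gronwallBound_of_liminf_deriv_right_le` with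
`gronwallBound δ A B x = δe^{Ax} + (B/A)(e^{Ax} − 1)`). [folklore] -/
private theorem le_mul_exp_of_deriv_le {E E' : ℝ → ℝ} {a b A B τ : ℝ} (hA : 1 ≤ A) (hB : 0 ≤ B)
    (hτ : b - a ≤ τ) (hE : ∀ t ∈ Icc a b, HasDerivWithinAt E (E' t) (Icc a b) t)
    (hle : ∀ t ∈ Icc a b, E' t ≤ A * E t + B) (hEa : 0 ≤ E a) {t : ℝ} (ht : t ∈ Icc a b) :
    E t ≤ (E a + B) * Real.exp (A * τ) := by
  have hEc : ContinuousOn E (Icc a b) := fun s hs => (hE s hs).continuousWithinAt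
  have hder : ∀ s ∈ Ico a b, HasDerivWithinAt E (E' s) (Ici s) s := fun s hs =>
    ((hE s (Ico_subset_Icc_self hs)).mono (Icc_subset_Icc hs.1 le_rfl)).mono_of_mem_nhdsWithin
      (Icc_mem_nhdsGE hs.2)
  have hgr := le_gronwallBound_of_liminf_deriv_right_le (f := E) (f' := E') (δ := E a) (K := A) (ε := B)
    (a := a) (b := b) hEc (fun s hs r hr => (hder s hs).liminf_right_slope_le hr) le_rfl
    (fun s hs => hle s (Ico_subset_Icc_self hs)) t ht
  have hA0 : A ≠ 0 := by positivity
  rw [gronwallBound_of_K_ne_0 hA0] at hgr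
  simp only at hgr
  have hta : t - a ≤ τ := by linarith [ht.2]
  have hexp : Real.exp (A * (t - a)) ≤ Real.exp (A * τ) :=
    Real.exp_le_exp.2 (mul_le_mul_of_nonneg_left hta (by linarith))
  have hexp0 : 0 < Real.exp (A * (t - a)) := Real.exp_pos _
  have hBA : B / A ≤ B := div_le_self hB hA
  calc E t ≤ E a * Real.exp (A * (t - a)) + B / A * (Real.exp (A * (t - a)) - 1) := hgr
    _ ≤ E a * Real.exp (A * τ) + B * Real.exp (A * τ) := by
        have h1 : E a * Real.exp (A * (t - a)) ≤ E a * Real.exp (A * τ) := mul_le_mul_of_nonneg_left hexp hEa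
        have h2 : B / A * (Real.exp (A * (t - a)) - 1) ≤ B * Real.exp (A * τ) := by
          have : B / A * (Real.exp (A * (t - a)) - 1) ≤ B / A * Real.exp (A * (t - a)) :=
            mul_le_mul_of_nonneg_left (by linarith) (div_nonneg hB (by linarith))
          exact this.trans (mul_le_mul hBA hexp hexp0.le hB)
        linarith
    _ = (E a + B) * Real.exp (A * τ) := by ring

/-- `2 √x √y ≤ x + y`. [folklore] -/
private theorem two_mul_sqrt_mul_sqrt_le {x y : ℝ} (hx : 0 ≤ x) (hy : 0 ≤ y) :
    2 * (Real.sqrt x * Real.sqrt y) ≤ x + y := by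
  nlinarith [Real.sq_sqrt hx, Real.sq_sqrt hy, sq_nonneg (Real.sqrt x - Real.sqrt y)]

end Gronwall

/-! ## §2 The word-energy balance and the vanishing nonlinear terms at the rungs `0` and `1` -/

section Balance

variable {d : Type*} [Fintype d] [DecidableEq d]

/-- The word-energy balance, un-halved: `d/dt E_N(u) = 2(−νE_{N+1}(u) − NL_N(u) + W_N(f, u))` within `[a, b]`
(tree `IsClassicalNSSolutionOn.hasDerivWithinAt_half_wordEnergy`; Doering–Gibbon (6.2.12)).
[cite: DoeringGibbon1995, §6.2 (6.2.12)] -/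
theorem _root_.Literature.Analysis.FunctionSpaces.Torus.IsClassicalNSSolutionOn.hasDerivWithinAt_wordEnergy
    {a b ν : ℝ} {f u : ℝ → UnitAddTorus d → EuclideanSpace ℝ d} {p : ℝ → UnitAddTorus d → ℝ}
    (h : Torus.IsClassicalNSSolutionOn (Icc a b) ν f u p) (hab : a < b) (N : ℕ) {t : ℝ} (ht : t ∈ Icc a b) :
    HasDerivWithinAt (fun s => wordEnergy N (u s))
      (2 * (-ν * wordEnergy (N + 1) (u t) - ladderNonlinear N (u t) + wordForcing N (f t) (u t))) (Icc a b) t := by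
  have h2 := (h.hasDerivWithinAt_half_wordEnergy hab N ht).const_mul 2
  have e : (fun s => 2 * (2⁻¹ * wordEnergy N (u s))) = fun s => wordEnergy N (u s) := by
    funext s; ring
  rwa [e] at h2

/-- **The rung `0`: the transport term is orthogonal to the transported field**, `NL_0(v) = ∫⟪(v·∇)v, v⟫ = 0`
for smooth divergence-free `v` (any dimension). [cite: DoeringGibbon1995, §6.2 (6.2.14)] -/
theorem ladderNonlinear_zero_eq_zero {v : UnitAddTorus d → EuclideanSpace ℝ d} (hv : IsSmooth v)
    (hdiv : IsDivFree v) : ladderNonlinear 0 v = 0 := by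
  unfold ladderNonlinear
  rw [Fintype.sum_unique]
  simp only [List.ofFn_zero, wordDeriv_nil]
  exact integral_inner_convect_self_right_eq_zero hv hdiv hv

/-- **The rung `1` in two dimensions: the trilinear term is orthogonal to the Laplacian**,
`NL_1(v) = ∑ᵢ ∫⟪∂ᵢ((v·∇)v), ∂ᵢv⟫ = −∫⟪(v·∇)v, Δv⟫ = 0` for smooth divergence-free `v : 𝕋² → ℝ²` (Green,
then FMRT (A.62), tree `integral_inner_laplacian_convect_self_eq_zero`). [cite: FoiasManleyRosaTemam2001, App. II.A (A.62)] -/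
theorem ladderNonlinear_one_eq_zero_fin_two {v : UnitAddTorus (Fin 2) → EuclideanSpace ℝ (Fin 2)}
    (hv : IsSmooth v) (hdiv : IsDivFree v) : ladderNonlinear 1 v = 0 := by
  unfold ladderNonlinear
  have e : ∑ w : Fin 1 → Fin 2, ∫ x, ⟪wordDeriv (List.ofFn w) (Torus.convect v v) x, wordDeriv (List.ofFn w) v x⟫ =
      ∑ i : Fin 2, ∫ x, ⟪Torus.partialDeriv i (Torus.convect v v) x, Torus.partialDeriv i v x⟫ := by
    rw [← (Equiv.funUnique (Fin 1) (Fin 2)).symm.sum_comp]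
    refine Finset.sum_congr rfl fun i _ => ?_
    have : List.ofFn ((Equiv.funUnique (Fin 1) (Fin 2)).symm i) = [i] := by
      simp [Equiv.funUnique, List.ofFn_succ]
    rw [this]
    rfl
  rw [e, sum_integral_inner_partialDeriv_eq_neg_integral_inner_laplacian (hv.convect hv) hv]
  have hcomm : ∫ x, ⟪Torus.convect v v x, Torus.laplacian v x⟫ = ∫ x, ⟪Torus.laplacian v x, Torus.convect v v x⟫ :=
    integral_congr_ae (ae_of_all _ fun x => real_inner_comm _ _)
  rw [hcomm, integral_inner_laplacian_convect_self_eq_zero hv hdiv, neg_zero]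

end Balance

/-! ## §3 The rungs as linear differential inequalities -/

section Rungs

variable {a b ν : ℝ} {f u : ℝ → UnitAddTorus (Fin 2) → EuclideanSpace ℝ (Fin 2)}
  {p : ℝ → UnitAddTorus (Fin 2) → ℝ}

/-- Force slices of a classical solution on a slab are smooth (read off the momentum equation). [folklore] -/
private theorem isSmooth_force_slice' (h : Torus.IsClassicalNSSolutionOn (Icc a b) ν f u p) (hab : a < b)
    {t : ℝ} (ht : t ∈ Icc a b) : IsSmooth (f t) := by
  have hut : IsSmooth (u t) := h.smooth_velocity.isSmooth_slice ht
  have hfun : f t = fun x => Torus.timeDerivWithin (Icc a b) u t x +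
      Torus.convect (u t) (u t) x - ν • Torus.laplacian (u t) x + Torus.gradient (p t) x := by
    funext x
    rw [h.momentum t ht x]
    abel
  rw [hfun]
  exact (((h.smooth_velocity.isSmooth_timeDerivWithin (uniqueDiffOn_Icc hab) ht).add (hut.convect hut)).sub
    (hut.laplacian.smul ν)).add (h.smooth_pressure.isSmooth_slice ht).gradient

/-- **Rungs `0` and `1` on the two-torus**: for a classical solution on `[a, b] × 𝕋²` (`ν ≥ 0`), `N ≤ 1`,
and a bound `Φ ≥ E_N(f(t))` on the window, `d/dt E_N(u) ≤ E_N(u) + Φ` (no nonlinear term: `NL_0 = 0` always,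
`NL_1 = 0` in two dimensions; the forcing pairing by Cauchy–Schwarz and `2√x√y ≤ x + y`).
[cite: FoiasManleyRosaTemam2001, App. II.A (A.62)–(A.65)] -/
theorem deriv_wordEnergy_le_low (h : Torus.IsClassicalNSSolutionOn (Icc a b) ν f u p) (hab : a < b)
    (hν : 0 ≤ ν) {N : ℕ} (hN : N ≤ 1) {Φ : ℝ} (hΦ : ∀ t ∈ Icc a b, wordEnergy N (f t) ≤ Φ)
    {t : ℝ} (ht : t ∈ Icc a b) :
    2 * (-ν * wordEnergy (N + 1) (u t) - ladderNonlinear N (u t) + wordForcing N (f t) (u t)) ≤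
      1 * wordEnergy N (u t) + Φ := by
  have hut : IsSmooth (u t) := h.smooth_velocity.isSmooth_slice ht
  have hft : IsSmooth (f t) := isSmooth_force_slice' h hab ht
  have hNL : ladderNonlinear N (u t) = 0 := by
    interval_cases N
    · exact ladderNonlinear_zero_eq_zero hut (h.divFree t ht)
    · exact ladderNonlinear_one_eq_zero_fin_two hut (h.divFree t ht)
  have hW := abs_wordForcing_le hft hut N
  have hW' : wordForcing N (f t) (u t) ≤ Real.sqrt (wordEnergy N (u t)) * Real.sqrt (wordEnergy N (f t)) :=
    (le_abs_self _).trans hW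
  have hE1 : 0 ≤ wordEnergy (N + 1) (u t) := wordEnergy_nonneg _ _
  have hsq := two_mul_sqrt_mul_sqrt_le (wordEnergy_nonneg N (u t)) (wordEnergy_nonneg N (f t))
  have hΦt := hΦ t ht
  nlinarith [mul_nonneg hν hE1]

/-- **Rung `N ≥ 2` on the two-torus.**  Let `(u, p)` be classical on `[a, b] × 𝕋²`, `ν > 0`, let `c ≥ 0` be
a constant with Ladyzhenskaya's bound below (for `N ≥ 2`: `Torus.exists_abs_ladderNonlinear_le_fin_two N`), `K ≥ 1` a bound for `E_1(u(t)), …, E_{N−1}(u(t))`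
on the window and `Φ ≥ E_N(f(t))` there.  Then `d/dt E_N(u) ≤ A E_N(u) + B` with
`A = c²K²/ν + 2cK + 1`, `B = 2cK² + Φ`: the dissipation `−νE_{N+1}` absorbs Ladyzhenskaya's
`cK(E_N E_{N+1})^{1/2}` (Young). [cite: Ladyzhenskaya1959, Thm. 1] -/
theorem deriv_wordEnergy_le_high (h : Torus.IsClassicalNSSolutionOn (Icc a b) ν f u p) (hab : a < b)
    (hν : 0 < ν) {N : ℕ} {c : ℝ} (hc0 : 0 ≤ c)
    (hc : ∀ (v : UnitAddTorus (Fin 2) → EuclideanSpace ℝ (Fin 2)), IsSmooth v → IsDivFree v →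
      ∀ K : ℝ, 1 ≤ K → (∀ i, 1 ≤ i → i ≤ N - 1 → wordEnergy i v ≤ K) →
        |ladderNonlinear N v| ≤ c * K * (wordEnergy N v + K + Real.sqrt (wordEnergy N v * wordEnergy (N + 1) v)))
    {K : ℝ} (hK : 1 ≤ K) (hEK : ∀ t ∈ Icc a b, ∀ i, 1 ≤ i → i ≤ N - 1 → wordEnergy i (u t) ≤ K)
    {Φ : ℝ} (hΦ : ∀ t ∈ Icc a b, wordEnergy N (f t) ≤ Φ) {t : ℝ} (ht : t ∈ Icc a b) :
    2 * (-ν * wordEnergy (N + 1) (u t) - ladderNonlinear N (u t) + wordForcing N (f t) (u t)) ≤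
      (c ^ 2 * K ^ 2 / ν + 2 * c * K + 1) * wordEnergy N (u t) + (2 * c * K ^ 2 + Φ) := by
  have hut : IsSmooth (u t) := h.smooth_velocity.isSmooth_slice ht
  have hft : IsSmooth (f t) := isSmooth_force_slice' h hab ht
  have hQ0 : 0 ≤ c ^ 2 * K ^ 2 / ν := by positivity
  set Q := c ^ 2 * K ^ 2 / ν with hQ
  set EN := wordEnergy N (u t) with hEN
  set EN1 := wordEnergy (N + 1) (u t) with hEN1
  have hEN0 : 0 ≤ EN := wordEnergy_nonneg _ _
  have hEN10 : 0 ≤ EN1 := wordEnergy_nonneg _ _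
  have hK0 : 0 ≤ K := by linarith
  have hNL := hc (u t) hut (h.divFree t ht) K hK (hEK t ht)
  set σ := Real.sqrt (EN * EN1) with hσ
  have hNL' : -ladderNonlinear N (u t) ≤ c * K * (EN + K + σ) := (neg_le_abs _).trans hNL
  have hNL2 : 2 * (-ladderNonlinear N (u t)) ≤ 2 * (c * K * EN) + 2 * (c * K ^ 2) + 2 * (c * K * σ) := by
    nlinarith [hNL']
  have hW := abs_wordForcing_le hft hut N
  have hW' : wordForcing N (f t) (u t) ≤ Real.sqrt EN * Real.sqrt (wordEnergy N (f t)) :=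
    (le_abs_self _).trans hW
  have hsq := two_mul_sqrt_mul_sqrt_le hEN0 (wordEnergy_nonneg N (f t))
  have hΦt := hΦ t ht
  have hW2 : 2 * wordForcing N (f t) (u t) ≤ EN + Φ := by linarith
  -- Young: `2 c K √(EN EN1) ≤ 2ν EN1 + (cK)²/(2ν) EN`, i.e. `0 ≤ (2ν√EN1 − cK√EN)² / (2ν)`
  have hyoung : 2 * (c * K * σ) ≤ 2 * (ν * EN1) + Q * EN / 2 := by
    rw [hσ, Real.sqrt_mul hEN0]
    have e1 : Real.sqrt EN ^ 2 = EN := Real.sq_sqrt hEN0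
    have e2 : Real.sqrt EN1 ^ 2 = EN1 := Real.sq_sqrt hEN10
    have hν0 : ν ≠ 0 := hν.ne'
    have key : 0 ≤ (2 * ν * Real.sqrt EN1 - c * K * Real.sqrt EN) ^ 2 / (2 * ν) := by positivity
    have expand : (2 * ν * Real.sqrt EN1 - c * K * Real.sqrt EN) ^ 2 / (2 * ν) =
        2 * (ν * Real.sqrt EN1 ^ 2) - 2 * (c * K * (Real.sqrt EN * Real.sqrt EN1)) +
          Q * Real.sqrt EN ^ 2 / 2 := by
      rw [hQ]
      field_simp
      ring
    rw [expand, e1, e2] at key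
    linarith
  have hQEN : 0 ≤ Q * EN := mul_nonneg hQ0 hEN0
  have hcKEN : 0 ≤ c * K * EN := mul_nonneg (mul_nonneg hc0 hK0) hEN0
  have hlhs : 2 * (-ν * EN1 - ladderNonlinear N (u t) + wordForcing N (f t) (u t)) =
      -(2 * (ν * EN1)) + 2 * (-ladderNonlinear N (u t)) + 2 * wordForcing N (f t) (u t) := by ring
  have hrhs : (Q + 2 * c * K + 1) * EN + (2 * c * K ^ 2 + Φ) =
      Q * EN + 2 * (c * K * EN) + EN + 2 * (c * K ^ 2) + Φ := by ring
  rw [hlhs, hrhs]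
  linarith

end Rungs

/-! ## §4 The a priori bounds -/

section APriori

/-- **A priori bounds for every word energy of classical forced Navier–Stokes solutions on `𝕋²`**
(Ladyzhenskaya 1959, Thm. 1; FMRT 2001, Thm. 7.4 with (A.62)–(A.67); Kuksin–Shirikyan 2012, Cor. 2.1.20;
Majda–Bertozzi 2002, §3.3 Cor. 3.3).  For every `N`, `ν > 0`, `τ`, `D ≥ 0`, `Φ ≥ 0` there is `B ≥ 0`
such that: for every classical solution `(u, p)` of `∂ₜu + (u·∇)u = νΔu − ∇p + f`, `div u = 0` on a window
`[a, b] × 𝕋²` of length `b − a ≤ τ` with `E_n(u(a)) ≤ D` and `E_n(f(t)) ≤ Φ` on the window for all `n ≤ N`,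
one has `E_n(u(t)) ≤ B` for all `n ≤ N` and `t ∈ [a, b]` — the bound does not depend on the solution or on
the window.  Induction on `N`: rungs `0`, `1` are linear outright (`deriv_wordEnergy_le_low`), rung
`N ≥ 2` is linear once the lower rungs are bounded (`deriv_wordEnergy_le_high`); Grönwall each time.
[cite: Ladyzhenskaya1959, Thm. 1] -/
theorem exists_wordEnergy_le_fin_two (N : ℕ) {ν τ D Φ : ℝ} (hν : 0 < ν) (hD : 0 ≤ D) (hΦ : 0 ≤ Φ) :
    ∃ B : ℝ, 0 ≤ B ∧ ∀ {a b : ℝ} {f u : ℝ → UnitAddTorus (Fin 2) → EuclideanSpace ℝ (Fin 2)}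
      {p : ℝ → UnitAddTorus (Fin 2) → ℝ}, a < b → b - a ≤ τ →
      Torus.IsClassicalNSSolutionOn (Icc a b) ν f u p →
      (∀ n, n ≤ N → wordEnergy n (u a) ≤ D) → (∀ n, n ≤ N → ∀ t ∈ Icc a b, wordEnergy n (f t) ≤ Φ) →
      ∀ n, n ≤ N → ∀ t ∈ Icc a b, wordEnergy n (u t) ≤ B := by
  -- the low rungs: a bound valid for `n ≤ 1` under the hypotheses at any level `≥ n`
  have hlow : ∀ {a b : ℝ} {f u : ℝ → UnitAddTorus (Fin 2) → EuclideanSpace ℝ (Fin 2)}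
      {p : ℝ → UnitAddTorus (Fin 2) → ℝ}, a < b → b - a ≤ τ →
      Torus.IsClassicalNSSolutionOn (Icc a b) ν f u p → ∀ n, n ≤ 1 → wordEnergy n (u a) ≤ D →
      (∀ t ∈ Icc a b, wordEnergy n (f t) ≤ Φ) → ∀ t ∈ Icc a b, wordEnergy n (u t) ≤ (D + Φ) * Real.exp (1 * τ) := by
    intro a b f u p hab hτab h n hn hDa hΦn t ht
    have hb := le_mul_exp_of_deriv_le (E := fun s => wordEnergy n (u s)) le_rfl hΦ hτab
      (fun s hs => h.hasDerivWithinAt_wordEnergy hab n hs)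
      (fun s hs => deriv_wordEnergy_le_low h hab hν.le hn hΦn hs) (wordEnergy_nonneg _ _) ht
    exact hb.trans (mul_le_mul_of_nonneg_right (by linarith) (Real.exp_pos _).le)
  induction N with
  | zero =>
      refine ⟨(D + Φ) * Real.exp (1 * τ), by positivity, ?_⟩
      intro a b f u p hab hτab h hDa hΦf n hn t ht
      have hn0 : n = 0 := by omega
      subst hn0
      exact hlow hab hτab h 0 (by omega) (hDa 0 le_rfl) (hΦf 0 le_rfl) t ht
  | succ M ih =>
      obtain ⟨B₁, hB₁0, hB₁⟩ := ih
      rcases Nat.lt_or_ge M 1 with hM | hM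
      · -- `N = 1`: both rungs are low
        have hM0 : M = 0 := by omega
        subst hM0
        refine ⟨(D + Φ) * Real.exp (1 * τ), by positivity, ?_⟩
        intro a b f u p hab hτab h hDa hΦf n hn t ht
        exact hlow hab hτab h n (by omega) (hDa n hn) (hΦf n hn) t ht
      · -- `N = M + 1 ≥ 2`: the lower rungs `1, …, M` are bounded by `B₁`
        obtain ⟨c, hc0, hc⟩ := exists_abs_ladderNonlinear_le_fin_two (M + 1) (by omega)
        set K : ℝ := max 1 B₁ with hK
        have hK1 : 1 ≤ K := le_max_left _ _
        set A : ℝ := c ^ 2 * K ^ 2 / ν + 2 * c * K + 1 with hA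
        set B' : ℝ := 2 * c * K ^ 2 + Φ with hB'
        have hA1 : 1 ≤ A := by
          have : 0 ≤ c ^ 2 * K ^ 2 / ν + 2 * c * K := by positivity
          simp only [hA]; linarith
        have hB'0 : 0 ≤ B' := by positivity
        refine ⟨max B₁ ((D + B') * Real.exp (A * τ)), le_max_of_le_left hB₁0, ?_⟩
        intro a b f u p hab hτab h hDa hΦf n hn t ht
        -- the lower rungs from the induction hypothesis
        have hlowM : ∀ m, m ≤ M → ∀ s ∈ Icc a b, wordEnergy m (u s) ≤ B₁ :=
          hB₁ hab hτab h (fun m hm => hDa m (by omega)) (fun m hm s hs => hΦf m (by omega) s hs)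
        rcases Nat.lt_or_ge n (M + 1) with hnM | hnM
        · exact (hlowM n (by omega) t ht).trans (le_max_left _ _)
        · have hnE : n = M + 1 := le_antisymm hn hnM
          subst hnE
          have hEK : ∀ s ∈ Icc a b, ∀ i, 1 ≤ i → i ≤ M + 1 - 1 → wordEnergy i (u s) ≤ K :=
            fun s hs i _ hi => (hlowM i (by omega) s hs).trans (le_max_right _ _)
          have hb := le_mul_exp_of_deriv_le (E := fun s => wordEnergy (M + 1) (u s)) hA1 hB'0 hτab
            (fun s hs => h.hasDerivWithinAt_wordEnergy hab (M + 1) hs)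
            (fun s hs => deriv_wordEnergy_le_high h hab hν hc0 hc hK1 hEK (hΦf (M + 1) le_rfl) hs)
            (wordEnergy_nonneg _ _) ht
          refine le_trans ?_ (le_max_right _ _)
          exact hb.trans (mul_le_mul_of_nonneg_right (by linarith [hDa (M + 1) le_rfl]) (Real.exp_pos _).le)

end APriori

end Torus

end Literature.Analysis.FluidPDE

end
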